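import Summits.CriticalPhenomena.PercolationContinuityZ3.Theorems.PercNearOneGluingNoHeavyLowerTailSahiWidthStratification

/-!
# `NoHeavyLowerTail` (crux stmt-CriticalPhenomena-4575), Sahi programme: the parametrised grid coupling WITH ITS PARAMETER
# COORDINATE EXPOSED — `G(t, ω) = (t, φ(t, ω))`

Support file (Sahi cell, seat `prim-sahi-p1`, generation 48; `--supports stmt-CriticalPhenomena-4575`).  Pure proofs, NO definitions,
no `sorry`, standard axioms.

`…SahiWidthStratification` (this seat, generation 3) proves `SahiWidth.exists_gridCoupling`: for a finite distributive parameter lattice `T`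
and an FKG weight `μ` on `T × [b+1]^d`, on every fine enough common quantile grid a MONOTONE map `G : T × [K]^d → T × [b+1]^d` pushes
`ν_T ⊗ (gaps)^{⊗d}` forward to `μ`.  The construction (conditional quantiles, coordinate by coordinate) never moves the parameter:
`G(t, ω) = (t, φ(t, ω))` — but the exported statement only says `Monotone G`, and a consumer that conditions on the parameter (here:
the coin coordinate of `Bool × (grid)`, for the tangent / contraction inequality `…SahiTangentFKGGrid`) needs the form.  Exactly as
generation 47 did for the chain case (`SahiTangent.exists_rowQuantile_coupling_fst`), this file re-proves the two couplings VERBATIM with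
the strengthened conclusions:
* `SahiThreeDim.exists_rowQuantile_coupling_snd` — the lattice-indexed row-quantile coupling of `…SahiThreeDimCoupling` is
  `(i, u) ↦ (i, q i u)` with `q` monotone in both arguments;
* `SahiWidth.exists_gridCoupling_fst` — the parametrised grid coupling is `x ↦ (x.1, φ x)` with `x ↦ (x.1, φ x)` monotone;
* `SahiWidth.exists_gridCoupling_fst_prod` — packaged with a concrete grid: for every FKG probability weight `μ` on `T × [b+1]^d` there are
  `K`, a probability weight `g` on `Fin (K+1)` and `φ` with `x ↦ (x.1, φ x)` monotone pushing `ν_T(t) · ∏_a g(ω_a)` forward to `μ`.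
Nothing new mathematically; bookkeeping for consumers. [this work]
-/

open Finset Function Literature.Combinatorics.Sahi2008
open scoped BigOperators

noncomputable section

namespace Summit.CriticalPhenomena.PercolationContinuityZ3.Theorems.SahiThreeDim

open SahiTwoDim

universe u

section Coupling

variable {ι : Type*} [PartialOrder ι] [Fintype ι] {b K : ℕ}

/-- **The lattice-indexed row-quantile coupling, explicit form** — `SahiThreeDim.exists_rowQuantile_coupling` re-proved verbatim with the
conclusion recording that the coupling is `(i, u) ↦ (i, q i u)` with `q` monotone in both arguments (the original exports only
`∃ G, Monotone G ∧ …`). [this work] -/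
theorem exists_rowQuantile_coupling_snd (μ : ι × Fin (b + 1) → ℝ) (hμ0 : ∀ p, 0 ≤ μ p)
    (hcross : ∀ i i' j, i ≤ i' → 0 < (∑ j, μ (i, j)) → 0 < (∑ j, μ (i', j)) →
      (∑ j', if j' ≤ j then μ (i', j') else 0) * (∑ j, μ (i, j)) ≤
        (∑ j', if j' ≤ j then μ (i, j') else 0) * (∑ j, μ (i', j)))
    (γ : Fin (K + 1) → ℝ) (hγ : StrictMono γ) (hγ1 : γ (Fin.last K) = 1) (hγ0 : γ 0 = 0)
    (hC : ∀ i j, 0 < (∑ j, μ (i, j)) → ∃ v, γ v * (∑ j, μ (i, j)) = (∑ j', if j' ≤ j then μ (i, j') else 0)) :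
    ∃ q : ι → Fin K → Fin (b + 1), (∀ i i' (u u' : Fin K), i ≤ i' → u ≤ u' → q i u ≤ q i' u') ∧
      pushWeight (fun p : ι × Fin K => (∑ j, μ (p.1, j)) * (γ p.2.succ - γ (Fin.castSucc p.2))) (fun p => (p.1, q p.1 p.2)) = μ := by
  classical
  have hne : ∀ i (u : Fin K), (univ.filter fun j : Fin (b + 1) =>
      γ u.succ * (∑ j, μ (i, j)) ≤ (∑ j', if j' ≤ j then μ (i, j') else 0)).Nonempty := by
    intro i u
    refine ⟨Fin.last b, ?_⟩
    rw [mem_filter, rowCDF_last]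
    refine ⟨mem_univ _, ?_⟩
    have hle : γ u.succ ≤ 1 := by rw [← hγ1]; exact hγ.monotone (Fin.le_last _)
    have hr : 0 ≤ ∑ j, μ (i, j) := sum_nonneg fun j _ => hμ0 _
    nlinarith
  obtain ⟨q₀, hq₀⟩ : ∃ q₀ : ι → Fin K → Fin (b + 1), ∀ i u j,
      q₀ i u ≤ j ↔ γ u.succ * (∑ j, μ (i, j)) ≤ (∑ j', if j' ≤ j then μ (i, j') else 0) := by
    refine ⟨fun i u => (univ.filter fun j : Fin (b + 1) =>
      γ u.succ * (∑ j, μ (i, j)) ≤ (∑ j', if j' ≤ j then μ (i, j') else 0)).min' (hne i u),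
      fun i u j => ⟨fun h => ?_, fun h => ?_⟩⟩
    · have hmem := min'_mem _ (hne i u)
      rw [mem_filter] at hmem
      exact hmem.2.trans (rowCDF_mono μ hμ0 i h)
    · exact min'_le _ _ (by rw [mem_filter]; exact ⟨mem_univ _, h⟩)
  have hq₀u : ∀ i (u u' : Fin K), u ≤ u' → q₀ i u ≤ q₀ i u' := by
    intro i u u' huu'
    rw [hq₀]
    have h1 : γ u'.succ * (∑ j, μ (i, j)) ≤ (∑ j', if j' ≤ q₀ i u' then μ (i, j') else 0) := (hq₀ i u' _).1 le_rfl
    have h2 : γ u.succ ≤ γ u'.succ := hγ.monotone (Fin.succ_le_succ_iff.2 huu')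
    have hr : 0 ≤ ∑ j, μ (i, j) := sum_nonneg fun j _ => hμ0 _
    nlinarith [mul_le_mul_of_nonneg_right h2 hr]
  have hq₀i : ∀ i i' (u : Fin K), i ≤ i' → 0 < (∑ j, μ (i, j)) → 0 < (∑ j, μ (i', j)) → q₀ i u ≤ q₀ i' u := by
    intro i i' u hii' hri hri'
    rw [hq₀]
    have h1 : γ u.succ * (∑ j, μ (i', j)) ≤ (∑ j', if j' ≤ q₀ i' u then μ (i', j') else 0) := (hq₀ i' u _).1 le_rfl
    have h3 := hcross i i' (q₀ i' u) hii' hri hri'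
    nlinarith [mul_le_mul_of_nonneg_right h1 hri.le]
  obtain ⟨q, hq⟩ : ∃ q : ι → Fin K → Fin (b + 1), ∀ i u,
      q i u = (univ.filter fun i' : ι => i' ≤ i ∧ 0 < ∑ j, μ (i', j)).sup fun i' => q₀ i' u := ⟨_, fun _ _ => rfl⟩
  have hq_pos : ∀ i u, 0 < (∑ j, μ (i, j)) → q i u = q₀ i u := by
    intro i u hri
    rw [hq]
    refine le_antisymm (Finset.sup_le fun i' hi' => ?_) ?_
    · rw [mem_filter] at hi'
      exact hq₀i i' i u hi'.2.1 hi'.2.2 hri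
    · exact Finset.le_sup (f := fun i' => q₀ i' u) (by rw [mem_filter]; exact ⟨mem_univ _, le_rfl, hri⟩)
  have hqmono : ∀ i i' (u u' : Fin K), i ≤ i' → u ≤ u' → q i u ≤ q i' u' := by
    intro i i' u u' hii' huu'
    rw [hq, hq]
    refine Finset.sup_le fun k hk => ?_
    rw [mem_filter] at hk
    exact (hq₀u k u u' huu').trans
      (Finset.le_sup (f := fun k => q₀ k u') (by rw [mem_filter]; exact ⟨mem_univ _, hk.2.1.trans hii', hk.2.2⟩))
  refine ⟨q, hqmono, ?_⟩
  have hcum : ∀ i j, 0 < (∑ j, μ (i, j)) → (∑ j, μ (i, j)) * ∑ u ∈ univ.filter (fun u : Fin K => q i u ≤ j),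
      (γ u.succ - γ (Fin.castSucc u)) = (∑ j', if j' ≤ j then μ (i, j') else 0) := by
    intro i j hri
    obtain ⟨v, hv⟩ := hC i j hri
    have hset : univ.filter (fun u : Fin K => q i u ≤ j) = univ.filter (fun u : Fin K => (u : ℕ) < v) := by
      ext u
      simp only [mem_filter, mem_univ, true_and, hq_pos i u hri, hq₀, ← hv]
      rw [mul_le_mul_iff_of_pos_right hri, hγ.le_iff_le, Fin.le_def, Fin.val_succ]
      omega
    rw [hset, sum_gaps γ v (by omega), hγ0, sub_zero]
    have : (⟨(v : ℕ), by omega⟩ : Fin (K + 1)) = v := Fin.ext rfl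
    rw [this, mul_comm, hv]
  have hfib : ∀ i j, 0 < (∑ j, μ (i, j)) → (∑ j, μ (i, j)) * ∑ u ∈ univ.filter (fun u : Fin K => q i u = j),
      (γ u.succ - γ (Fin.castSucc u)) = μ (i, j) := by
    intro i j hri
    induction j using Fin.cases with
    | zero =>
      have hset : univ.filter (fun u : Fin K => q i u = 0) = univ.filter (fun u : Fin K => q i u ≤ 0) := by
        ext u; simp
      rw [hset, hcum i 0 hri, rowCDF_zero]
    | succ j' =>
      have hset : univ.filter (fun u : Fin K => q i u ≤ j'.succ) =
          univ.filter (fun u : Fin K => q i u ≤ Fin.castSucc j') ∪ univ.filter (fun u : Fin K => q i u = j'.succ) := by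
        ext u
        simp only [mem_filter, mem_univ, true_and, mem_union]
        constructor
        · intro h
          rcases lt_or_eq_of_le h with h | h
          · exact Or.inl (Fin.le_castSucc_iff.2 h)
          · exact Or.inr h
        · rintro (h | h)
          · exact h.trans (Fin.castSucc_le_succ j')
          · exact h.le
      have hdisj : Disjoint (univ.filter (fun u : Fin K => q i u ≤ Fin.castSucc j'))
          (univ.filter (fun u : Fin K => q i u = j'.succ)) := by
        rw [disjoint_filter]
        intro u _ h1 h2
        rw [h2] at h1
        exact absurd h1 (not_le.2 Fin.castSucc_lt_succ)
      have h := hcum i j'.succ hri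
      rw [hset, sum_union hdisj, mul_add, hcum i _ hri, rowCDF_succ] at h
      linarith
  funext ⟨i, j⟩
  rw [pushWeight_apply, Fintype.sum_prod_type, Finset.sum_eq_single i]
  · by_cases hri : 0 < (∑ j, μ (i, j))
    · rw [← hfib i j hri, mul_sum, ← sum_filter]
      refine sum_congr ?_ fun u _ => rfl
      ext u
      simp
    · rw [row_eq_zero_of_mass μ hμ0 hri j]
      refine sum_eq_zero fun u _ => ?_
      have hr0 : (∑ j, μ (i, j)) = 0 := le_antisymm (not_lt.1 hri) (sum_nonneg fun j _ => hμ0 _)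
      split_ifs <;> simp [hr0]
  · intro i' _ hi'
    refine sum_eq_zero fun u _ => ?_
    rw [if_neg]
    intro h
    exact hi' (Prod.mk.inj h).1
  · exact fun h => (h (mem_univ _)).elim

end Coupling

end Summit.CriticalPhenomena.PercolationContinuityZ3.Theorems.SahiThreeDim

namespace Summit.CriticalPhenomena.PercolationContinuityZ3.Theorems.SahiWidth

open SahiTwoDim SahiThreeDim

universe u

section Coupling

/-- **The parametrised grid coupling, explicit form** — `SahiWidth.exists_gridCoupling` re-proved verbatim with the conclusion recording
that the coupling FIXES THE PARAMETER: `G x = (x.1, φ x)`.  For a finite distributive parameter lattice `T` and an FKG probability weight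
`μ` on `T × [b+1]^d` there is a finite `C₀ ⊆ [0,1]` such that for every strictly increasing grid `0 = γ_0 < ⋯ < γ_K = 1` containing `C₀`,
with gap weights `g`, some `φ : T × [K]^d → [b+1]^d` with `x ↦ (x.1, φ x)` MONOTONE pushes `ν_T(t) · ∏_i g(ω_i)` forward to `μ`.
[this work] -/
theorem exists_gridCoupling_fst : ∀ (d : ℕ) {T : Type u} [DistribLattice T] [Fintype T] (b : ℕ)
    (μ : T × (Fin d → Fin (b + 1)) → ℝ), IsFKGMeasure μ →
    ∃ C₀ : Finset ℝ, (∀ c ∈ C₀, 0 ≤ c ∧ c ≤ 1) ∧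
      ∀ (K : ℕ) (γ : Fin (K + 1) → ℝ) (g : Fin K → ℝ), StrictMono γ → γ 0 = 0 → γ (Fin.last K) = 1 →
        (∀ u, g u = γ u.succ - γ (Fin.castSucc u)) → (∀ c ∈ C₀, ∃ v, γ v = c) →
        ∃ φ : T × (Fin d → Fin K) → (Fin d → Fin (b + 1)), Monotone (fun x : T × (Fin d → Fin K) => (x.1, φ x)) ∧
          pushWeight (fun x : T × (Fin d → Fin K) => (∑ m, μ (x.1, m)) * ∏ i, g (x.2 i))
            (fun x : T × (Fin d → Fin K) => (x.1, φ x)) = μ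
  | 0, T, _, _, b, μ, hμ => by
    classical
    refine ⟨∅, fun c hc => absurd hc (Finset.notMem_empty c), ?_⟩
    intro K γ g _ _ _ _ _
    refine ⟨fun _ => default, fun x y h => ⟨h.1, le_rfl⟩, ?_⟩
    funext ⟨t, m⟩
    have hm : m = default := Subsingleton.elim _ _
    subst hm
    rw [pushWeight_apply, Fintype.sum_prod_type]
    rw [Finset.sum_eq_single t]
    · rw [Fintype.sum_unique, if_pos rfl, Fintype.prod_empty, mul_one, Fintype.sum_unique]
      exact congrArg μ (Prod.ext rfl (Subsingleton.elim _ _))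
    · intro t' _ ht'
      refine sum_eq_zero fun ω _ => if_neg fun h => ht' (Prod.mk.inj h).1
    · exact fun h => (h (mem_univ _)).elim
  | d + 1, T, _, _, b, μ, hμ => by
    classical
    obtain ⟨e, he⟩ : ∃ e : Fin (b + 1) × (Fin d → Fin (b + 1)) ≃o (Fin (d + 1) → Fin (b + 1)),
        e = Fin.consOrderIso fun _ => Fin (b + 1) := ⟨_, rfl⟩
    obtain ⟨E, hE⟩ : ∃ E : (T × Fin (b + 1)) × (Fin d → Fin (b + 1)) ≃ T × (Fin (d + 1) → Fin (b + 1)),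
        ∀ x, E x = (x.1.1, e (x.1.2, x.2)) :=
      ⟨(Equiv.prodAssoc _ _ _).trans ((Equiv.refl T).prodCongr e.toEquiv), fun x => rfl⟩
    have hEmono : Monotone E := fun x y h => by
      rw [hE, hE]
      exact ⟨h.1.1, e.monotone ⟨h.1.2, h.2⟩⟩
    have hEinf : ∀ x y, E (x ⊓ y) = E x ⊓ E y := fun x y => by
      rw [hE, hE, hE]
      refine Prod.ext rfl ?_
      show e ((x ⊓ y).1.2, (x ⊓ y).2) = e (x.1.2, x.2) ⊓ e (y.1.2, y.2)
      rw [← e.map_inf]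
      rfl
    have hEsup : ∀ x y, E (x ⊔ y) = E x ⊔ E y := fun x y => by
      rw [hE, hE, hE]
      refine Prod.ext rfl ?_
      show e ((x ⊔ y).1.2, (x ⊔ y).2) = e (x.1.2, x.2) ⊔ e (y.1.2, y.2)
      rw [← e.map_sup]
      rfl
    obtain ⟨μ'', hμ''⟩ : ∃ μ'' : (T × Fin (b + 1)) × (Fin d → Fin (b + 1)) → ℝ, μ'' = fun x => μ (E x) := ⟨_, rfl⟩
    have hFKG'' : IsFKGMeasure μ'' := by
      refine ⟨fun x => by rw [hμ'']; exact hμ.nonneg _, ?_, fun x y => ?_⟩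
      · rw [hμ'', ← hμ.sum_eq_one]
        exact E.sum_comp (fun p => μ p)
      · rw [hμ'']
        have h := hμ.mul_le_mul (E x) (E y)
        rwa [← hEinf, ← hEsup] at h
    have hpushE : pushWeight μ'' E = μ := by
      funext q
      rw [pushWeight_equiv, hμ'']
      exact congrArg μ (E.apply_symm_apply q)
    obtain ⟨C₀', hC₀'01, hIH⟩ := exists_gridCoupling_fst d b μ'' hFKG''
    obtain ⟨ν, hν⟩ : ∃ ν : T × Fin (b + 1) → ℝ, ν = fun y => ∑ m, μ'' (y, m) := ⟨_, rfl⟩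
    have hνFKG : IsFKGMeasure ν := by
      rw [hν, ← pushWeight_fst_eq]
      exact hFKG''.pushWeight_fst
    obtain ⟨C₁, hC₁⟩ : ∃ C₁ : Finset ℝ, C₁ = univ.image fun p : T × Fin (b + 1) =>
        (∑ j', if j' ≤ p.2 then ν (p.1, j') else 0) / (∑ j, ν (p.1, j)) := ⟨_, rfl⟩
    have hC₁01 : ∀ c ∈ C₁, 0 ≤ c ∧ c ≤ 1 := by
      intro c hc
      rw [hC₁, mem_image] at hc
      obtain ⟨p, _, rfl⟩ := hc
      by_cases hr : 0 < ∑ j, ν (p.1, j)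
      · exact ⟨div_nonneg (rowCDF_nonneg ν hνFKG.nonneg _ _) hr.le,
          (div_le_one hr).2 (rowCDF_le_rowMass ν hνFKG.nonneg _ _)⟩
      · have hr0 : (∑ j, ν (p.1, j)) = 0 := le_antisymm (not_lt.1 hr) (sum_nonneg fun j _ => hνFKG.nonneg _)
        rw [hr0, div_zero]
        exact ⟨le_rfl, zero_le_one⟩
    refine ⟨C₀' ∪ C₁, fun c hc => ?_, ?_⟩
    · rcases mem_union.1 hc with hc | hc
      · exact hC₀'01 c hc
      · exact hC₁01 c hc
    intro K γ g hγ hγ0 hγ1 hg hγC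
    obtain ⟨φ', hG'mono, hG'push⟩ := hIH K γ g hγ hγ0 hγ1 hg fun c hc => hγC c (mem_union_left _ hc)
    have hC : ∀ i j, 0 < (∑ j, ν (i, j)) →
        ∃ v, γ v * (∑ j, ν (i, j)) = (∑ j', if j' ≤ j then ν (i, j') else 0) := by
      intro i j hri
      obtain ⟨v, hv⟩ := hγC _ (mem_union_right _ (by rw [hC₁]; exact mem_image_of_mem _ (mem_univ (i, j))))
      exact ⟨v, by rw [hv, div_mul_cancel₀ _ hri.ne']⟩
    obtain ⟨q, hqmono, hG₁push⟩ := exists_rowQuantile_coupling_snd ν hνFKG.nonneg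
      (fun i i' j hii' _ _ => SahiThreeDim.cdf_cross_of_mul_le_mul ν hνFKG.mul_le_mul hii' j) γ hγ hγ1 hγ0 hC
    have hG₁mono : Monotone (fun p : T × Fin K => (p.1, q p.1 p.2)) :=
      fun p p' hpp' => ⟨hpp'.1, hqmono _ _ _ _ hpp'.1 hpp'.2⟩
    have hG₁push' : pushWeight (fun p : T × Fin K => (∑ j, ν (p.1, j)) * g p.2) (fun p => (p.1, q p.1 p.2)) = ν := by
      refine Eq.trans ?_ hG₁push
      congr 1
      funext p
      rw [hg]
    obtain ⟨eK, heK⟩ : ∃ eK : Fin K × (Fin d → Fin K) ≃o (Fin (d + 1) → Fin K),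
        eK = Fin.consOrderIso fun _ => Fin K := ⟨_, rfl⟩
    obtain ⟨F₁, hF₁⟩ : ∃ F₁ : T × (Fin (d + 1) → Fin K) ≃ (T × Fin K) × (Fin d → Fin K),
        ∀ y, F₁.symm y = (y.1.1, eK (y.1.2, y.2)) :=
      ⟨((Equiv.prodAssoc _ _ _).trans ((Equiv.refl T).prodCongr eK.toEquiv)).symm, fun y => rfl⟩
    have hF₁mono : Monotone F₁ := by
      intro x y h
      have h1 : F₁.symm (F₁ x) ≤ F₁.symm (F₁ y) := by rw [F₁.symm_apply_apply, F₁.symm_apply_apply]; exact h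
      rw [hF₁, hF₁] at h1
      obtain ⟨h11, h12⟩ := h1
      have h2 := eK.le_iff_le.1 h12
      exact ⟨⟨h11, h2.1⟩, h2.2⟩
    have hF₁fst : ∀ x : T × (Fin (d + 1) → Fin K), (F₁ x).1.1 = x.1 := by
      intro x
      have h := hF₁ (F₁ x)
      rw [F₁.symm_apply_apply] at h
      exact ((Prod.ext_iff.1 h).1).symm
    -- the composite coupling, and its first coordinate
    obtain ⟨Gc, hGc⟩ : ∃ Gc : T × (Fin (d + 1) → Fin K) → T × (Fin (d + 1) → Fin (b + 1)),
        Gc = fun x => E ((((F₁ x).1.1, q (F₁ x).1.1 (F₁ x).1.2),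
          φ' (((F₁ x).1.1, q (F₁ x).1.1 (F₁ x).1.2), (F₁ x).2))) := ⟨_, rfl⟩
    have hGcfst : ∀ x, (Gc x).1 = x.1 := by
      intro x
      rw [hGc]
      show (E _).1 = x.1
      rw [hE]
      exact hF₁fst x
    have hGcmono : Monotone Gc := by
      intro x y h
      have h1 := hF₁mono h
      rw [hGc]
      refine hEmono (hG'mono (show ((((F₁ x).1.1, q (F₁ x).1.1 (F₁ x).1.2), (F₁ x).2) :
          (T × Fin (b + 1)) × (Fin d → Fin K)) ≤ (((F₁ y).1.1, q (F₁ y).1.1 (F₁ y).1.2), (F₁ y).2) from ?_))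
      exact ⟨⟨h1.1.1, hqmono _ _ _ _ h1.1.1 h1.1.2⟩, h1.2⟩
    have hform : (fun x : T × (Fin (d + 1) → Fin K) => (x.1, (Gc x).2)) = Gc := by
      funext x
      exact Prod.ext (hGcfst x).symm rfl
    refine ⟨fun x => (Gc x).2, by rw [hform]; exact hGcmono, ?_⟩
    rw [hform]
    have hmass : ∀ t : T, (∑ m, μ (t, m)) = ∑ j, ν (t, j) := by
      intro t
      rw [hν]
      simp only [hμ'', hE]
      rw [sum_grid_succ]
      exact sum_congr rfl fun a _ => (sum_congr rfl fun ω _ => by rw [he])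
    have h1 : pushWeight (fun x : T × (Fin (d + 1) → Fin K) => (∑ m, μ (x.1, m)) * ∏ i, g (x.2 i)) F₁ =
        fun y => ((∑ j, ν (y.1.1, j)) * g y.1.2) * ∏ i, g (y.2 i) := by
      funext y
      rw [pushWeight_equiv, hF₁, hmass]
      show (∑ j, ν (y.1.1, j)) * ∏ i, g ((eK (y.1.2, y.2)) i) = _
      rw [heK, prod_consOrderIso, mul_assoc]
    have h2 : pushWeight (fun y : (T × Fin K) × (Fin d → Fin K) => ((∑ j, ν (y.1.1, j)) * g y.1.2) * ∏ i, g (y.2 i))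
        (fun y => ((y.1.1, q y.1.1 y.1.2), y.2)) = fun z => ν z.1 * ∏ i, g (z.2 i) := by
      rw [pushWeight_prodMap_id (fun p : T × Fin K => (∑ j, ν (p.1, j)) * g p.2) (fun ω : Fin d → Fin K => ∏ i, g (ω i))
        (fun p : T × Fin K => (p.1, q p.1 p.2)), hG₁push']
    have h3 : pushWeight (fun z : (T × Fin (b + 1)) × (Fin d → Fin K) => ν z.1 * ∏ i, g (z.2 i))
        (fun y : (T × Fin (b + 1)) × (Fin d → Fin K) => (y.1, φ' y)) = μ'' := by
      rw [← hG'push]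
      congr 1
      funext z
      rw [hν]
    have hcomp : Gc = E ∘ (fun y : (T × Fin (b + 1)) × (Fin d → Fin K) => (y.1, φ' y)) ∘
        (fun y : (T × Fin K) × (Fin d → Fin K) => ((y.1.1, q y.1.1 y.1.2), y.2)) ∘ F₁ := by
      rw [hGc]; rfl
    rw [hcomp, ← pushWeight_pushWeight, ← pushWeight_pushWeight, ← pushWeight_pushWeight, h1, h2, h3, hpushE]

/-- **The parametrised grid coupling with a concrete grid.**  For an FKG probability weight `μ` on `T × [b+1]^d` (`T` a finite
distributive lattice) there are `K`, a probability weight `g` on `Fin (K+1)` and `φ : T × [K+1]^d → [b+1]^d` such that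
`x ↦ (x.1, φ x)` is monotone and pushes `ν_T(t) · ∏_a g(ω_a)` (`ν_T(t) = Σ_m μ(t,m)`) forward to `μ`. [this work] -/
theorem exists_gridCoupling_fst_prod (d : ℕ) {T : Type u} [DistribLattice T] [Fintype T] {b : ℕ}
    {μ : T × (Fin d → Fin (b + 1)) → ℝ} (hμ : IsFKGMeasure μ) :
    ∃ (K : ℕ) (g : Fin (K + 1) → ℝ), (∀ u, 0 ≤ g u) ∧ (∑ u, g u = 1) ∧
      ∃ φ : T × (Fin d → Fin (K + 1)) → (Fin d → Fin (b + 1)), Monotone (fun x : T × (Fin d → Fin (K + 1)) => (x.1, φ x)) ∧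
        pushWeight (fun x : T × (Fin d → Fin (K + 1)) => (∑ m, μ (x.1, m)) * ∏ i, g (x.2 i))
          (fun x : T × (Fin d → Fin (K + 1)) => (x.1, φ x)) = μ := by
  classical
  obtain ⟨C₀, hC₀01, hcoup⟩ := exists_gridCoupling_fst d b μ hμ
  obtain ⟨C, hC⟩ : ∃ C : Finset ℝ, C = insert 0 (insert 1 C₀) := ⟨_, rfl⟩
  have h0C : (0 : ℝ) ∈ C := by rw [hC]; exact mem_insert_self _ _
  have h1C : (1 : ℝ) ∈ C := by rw [hC]; exact mem_insert_of_mem (mem_insert_self _ _)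
  have hCb : ∀ c ∈ C, 0 ≤ c ∧ c ≤ 1 := by
    intro c hc
    rw [hC, mem_insert, mem_insert] at hc
    rcases hc with rfl | rfl | hc
    · exact ⟨le_rfl, zero_le_one⟩
    · exact ⟨zero_le_one, le_rfl⟩
    · exact hC₀01 c hc
  have hcard : 2 ≤ C.card := by
    have : ({0, 1} : Finset ℝ) ⊆ C := by
      intro c hc
      simp only [mem_insert, mem_singleton] at hc
      rcases hc with rfl | rfl
      · exact h0C
      · exact h1C
    calc 2 = ({0, 1} : Finset ℝ).card := by rw [card_pair zero_ne_one]
      _ ≤ C.card := card_le_card this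
  obtain ⟨K, hK⟩ : ∃ K, C.card = (K + 1) + 1 := ⟨C.card - 2, by omega⟩
  obtain ⟨γ, hγdef⟩ : ∃ γ : Fin (K + 1 + 1) → ℝ, γ = fun v => C.orderEmbOfFin hK v := ⟨_, rfl⟩
  have hγ : StrictMono γ := by rw [hγdef]; exact (C.orderEmbOfFin hK).strictMono
  have hγ0 : γ 0 = 0 := by
    rw [hγdef]
    show C.orderEmbOfFin hK ⟨0, by omega⟩ = 0
    rw [orderEmbOfFin_zero hK (by omega)]
    exact le_antisymm (min'_le _ _ h0C) ((hCb _ (min'_mem _ _)).1)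
  have hγ1 : γ (Fin.last (K + 1)) = 1 := by
    rw [hγdef]
    show C.orderEmbOfFin hK ⟨K + 1, by omega⟩ = 1
    have h := orderEmbOfFin_last hK (by omega)
    simp only [Nat.add_sub_cancel] at h
    rw [h]
    exact le_antisymm ((hCb _ (max'_mem _ _)).2) (le_max' _ _ h1C)
  have hγC : ∀ c ∈ C₀, ∃ v, γ v = c := by
    intro c hc
    have h : c ∈ Set.range (C.orderEmbOfFin hK) := by
      rw [range_orderEmbOfFin, hC]; exact mem_insert_of_mem (mem_insert_of_mem hc)
    obtain ⟨v, hv⟩ := h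
    exact ⟨v, by rw [hγdef]; exact hv⟩
  obtain ⟨φ, hmono, hpush⟩ := hcoup (K + 1) γ (fun u => γ u.succ - γ (Fin.castSucc u)) hγ hγ0 hγ1 (fun u => rfl) hγC
  exact ⟨K, fun u => γ u.succ - γ (Fin.castSucc u), fun u => sub_nonneg.2 (hγ.monotone (Fin.castSucc_le_succ u)),
    sum_gaps_univ γ hγ0 hγ1, φ, hmono, hpush⟩

end Coupling

end Summit.CriticalPhenomena.PercolationContinuityZ3.Theorems.SahiWidth

end
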